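import Summits.BirchSwinnertonDyer.BirchSwinnertonDyer.Theorems.SignedLowerHalvesSmallImageLowerHalfBothSignsRttRecipMTOfValuesCyclo
import Summits.BirchSwinnertonDyer.BirchSwinnertonDyer.Theorems.SignedLowerHalvesSmallImageLowerHalfBothSignsRttReciprocityUniqueRelay
import Summits.BirchSwinnertonDyer.BirchSwinnertonDyer.Theorems.SignedLowerHalvesSmallImageLowerHalfBothSignsRttColemanPerrinRiou
import HarnessLib

/-!
# Route `SignedLowerHalves`, crux L `SmallImageLowerHalfBothSigns` (stmt-BirchSwinnertonDyer-23599), line `rtt_w3` v37 — row S4″ (`stub_junctionRecipMT_ns`), brick β7 (ASSEMBLY),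
# LEAD g15, part 2: ★★★ VALUES AT PRIMITIVE CHARACTERS ⟹ THE LEVELWISE MAZUR–TATE CONGRUENCES OF S4″

The S4″ contract for the hands (cell `bsd-ssimc`, LEAD `cruxlead-stmt-BirchSwinnertonDyer-23599` g15). Inputs, all in tree currency:
* the β4 READOUT of the interpolating signed Coleman map (-w3 g28, `exists_colemanEquiv_cofree`, last conjunct), for the one element `Y = (a·)Col(jv(s ζ̄_𝔞)) ∈ 𝒪_S⟦T⟧`:
  `ω_n^∓·Y ≡ R_n := Σ_{i<pⁿ} ev_{n,i}·(1+T)^{pⁿ−i} (mod ω_n)`;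
* the prefix's `hcongr` for the signed `p`-adic `L`-function `L ∈ 𝒪_T⟦T⟧` (`T = range ι`): `θ_n ≡ (−1)^{n/2+1} ω_n^∓·L (mod ω_n)` in `𝒪_T⟦T⟧ ⊗ ℚ`, `θ_n = θ_n(g;Ω)^ι` with an integral lift `Θ_n ∈ 𝒪_T[T]`
  (cohomological period, `ResidualThetaLayer.exists_map_eq_map_mazurTateElementK`);
* a unit `U ∈ 𝒪_S⟦T⟧ˣ` with polynomial representatives `u_n ≡ U (mod ω_n)` (the 𝔞-factor `N𝔞 − ψ̄(𝔞)σ_𝔞` and the `χ(q)`-type constants of the explicit reciprocity law);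
* ★ the VALUE IDENTITIES AT PRIMITIVE CHARACTERS ONLY: `d·u_n(ζ−1)·θ_n(ζ−1) = (−1)^{n/2+1}·c·R_n(ζ−1)` for every primitive `pⁿ`-th root of unity `ζ ∈ ℚ̄_p`, all `n ≥ n₀` of parity `ε`
  (bricks β2/β3: Wiles' explicit reciprocity law and the `L`-values of elliptic units — -w3; bricks β5/β6: Mazur–Tate interpolation and the period transport — honda g30).
Output: ★★★ `C_mul_iwasawaO_eq_of_primitive_values` — `c·ι(U⁻¹·Y) = d·ι(L)` in `ℚ̄_p⟦T⟧`; ★★★ `isCongrModOmegaO_of_primitive_values` — the REGISTERED conclusion shape of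
`CharRoadRecipMT`: `d·θ_n ≡ (−1)^{n/2+1} ω_n^∓·(c·ι(U⁻¹·Y)) (mod ω_n)` over `S ∪ T` for every `n` of parity `ε` (so `Col := U⁻¹•Col₀` closes S4″). Method: the identity principle in
`𝒪⟦T⟧` — at each level the comparison polynomial vanishes at the primitive roots, so `Φ_{pⁿ}(1+T)` divides `c·U⁻¹Y − d·L` after cancelling `ω_n^∓` (`Φ_{pⁿ}(1+T) = p + ω_{n−1}H`) and a power of
`p` (`PollackPairK.exists_eq_mul_of_C_mul_eq_mul_of_ne_zero`); unbounded degrees force `0` (`PollackPairK.eq_zero_of_forall_dvd_of_map_eq_X_pow`). NO imprimitive or trivial characters,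
NO bottom layer, NO norm relations are needed. THEOREMS ONLY (`--supports stmt-BirchSwinnertonDyer-23599` helper); closes nothing; S4″, crux L and BSD remain OPEN, proved for NO curve.
References: [Kobayashi2003] Thm. 6.3; [Pollack2003] §6.5 Prop. 6.18; [PollackRubin2004] §6–§7; [KimPark2017] Prop. 3.3, §3.5; [Washington1997] §7.1.
-/

set_option autoImplicit false
-- the Theorems namespace of this sub repeats the summit name by design (D-0017 nested layout)
set_option linter.dupNamespace false

noncomputable section

open Polynomial
open Literature.NumberTheory.EllipticCurves
open Summit.BirchSwinnertonDyer.BirchSwinnertonDyer.Theorems.ThetaTransport.MazurTateValuesRelay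
open Summit.BirchSwinnertonDyer.BirchSwinnertonDyer.Theorems.PollackPairK

namespace Summit.BirchSwinnertonDyer.BirchSwinnertonDyer.Theorems.SmallImageRttReciprocity

variable {p : ℕ} [hp : Fact p.Prime]

/-! ## §1 One level: the comparison polynomial vanishes at the primitive `p^{m+1}`-th roots ⟹ `Φ_{p^{m+1}}(1+T) ∣ c·U⁻¹Y − d·L` in `𝒪⟦T⟧` -/

/-- ★★ **One level of the identity principle.** Over one coefficient ring `𝒪 = 𝒪_{S'}` (a DVR), at a level `n = m+1` of parity `ε`: from the readout `ω_n^∓·Y − R = ω_n·q₁`, the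
representative `U − u = ω_n·q₃`, the scaled congruence `p^N·(Θ − (−1)^{n/2+1}ω_n^∓·L) = ω_n·q₂`, and the vanishing of `c·R − (−1)^{n/2+1}d·u·Θ` at `ζ − 1` for every primitive
`pⁿ`-th root of unity `ζ`, conclude `Φ_{pⁿ}(1+T) ∣ c·(U⁻¹·Y) − d·L` in `𝒪⟦T⟧`. [cite: Kobayashi2003, Thm. 6.3] [cite: Washington1997, §7.1] [folklore] -/
theorem cyclotomic_comp_dvd_of_level_values (S' : Set (PadicAlgCl p)) [FiniteDimensional ℚ_[p] (padicCoeffField S')]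
    (ε : ℤˣ) (m : ℕ) (hpar : Even (m + 1) ↔ ε = 1)
    (Θ u R : (padicCoeffIntegers S')[X]) (L Y U Uinv q₁ q₂ q₃ : IwasawaAlgebraO S') (hU : U * Uinv = 1) (N : ℕ) (c d : padicCoeffIntegers S')
    (hread : (((if ε = 1 then cyclotomicOmegaMinus p (m + 1) else cyclotomicOmegaPlus p (m + 1)).map (Int.castRingHom (padicCoeffIntegers S')) :
        (padicCoeffIntegers S')[X]) : IwasawaAlgebraO S') * Y - (R : IwasawaAlgebraO S') =
      (((cyclotomicOmega p (m + 1)).map (Int.castRingHom (padicCoeffIntegers S')) : (padicCoeffIntegers S')[X]) : IwasawaAlgebraO S') * q₁)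
    (hu : U - (u : IwasawaAlgebraO S') =
      (((cyclotomicOmega p (m + 1)).map (Int.castRingHom (padicCoeffIntegers S')) : (padicCoeffIntegers S')[X]) : IwasawaAlgebraO S') * q₃)
    (hL : PowerSeries.C (((p : ℕ) : padicCoeffIntegers S') ^ N) * ((Θ : IwasawaAlgebraO S') -
        ((((-1) ^ ((m + 1) / 2 + 1) * (if ε = 1 then cyclotomicOmegaMinus p (m + 1) else cyclotomicOmegaPlus p (m + 1))).map
          (Int.castRingHom (padicCoeffIntegers S')) : (padicCoeffIntegers S')[X]) : IwasawaAlgebraO S') * L) =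
      (((cyclotomicOmega p (m + 1)).map (Int.castRingHom (padicCoeffIntegers S')) : (padicCoeffIntegers S')[X]) : IwasawaAlgebraO S') * q₂)
    (hval : ∀ ζ : PadicAlgCl p, IsPrimitiveRoot ζ (p ^ (m + 1)) →
      ((Polynomial.C c * R - Polynomial.C ((-1) ^ ((m + 1) / 2 + 1) * d) * u * Θ).map (padicCoeffIntegers S').subtype).eval (ζ - 1) = 0) :
    ((((cyclotomic (p ^ (m + 1)) ℤ).comp (X + 1)).map (Int.castRingHom (padicCoeffIntegers S')) : (padicCoeffIntegers S')[X]) : IwasawaAlgebraO S') ∣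
      PowerSeries.C c * (Uinv * Y) - PowerSeries.C d * L := by
  haveI : IsDiscreteValuationRing (padicCoeffIntegers S') := isDiscreteValuationRing_padicCoeffIntegers
  haveI : CharP (IsLocalRing.ResidueField (padicCoeffIntegers S')) p := charP_residueField_padicCoeffIntegers
  -- names for the power series involved
  set Φ : IwasawaAlgebraO S' := ((((cyclotomic (p ^ (m + 1)) ℤ).comp (X + 1)).map (Int.castRingHom (padicCoeffIntegers S')) :
    (padicCoeffIntegers S')[X]) : IwasawaAlgebraO S') with hΦ
  set ωs : IwasawaAlgebraO S' := (((if ε = 1 then cyclotomicOmegaMinus p (m + 1) else cyclotomicOmegaPlus p (m + 1)).map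
    (Int.castRingHom (padicCoeffIntegers S')) : (padicCoeffIntegers S')[X]) : IwasawaAlgebraO S') with hωs
  set ωn : IwasawaAlgebraO S' := (((cyclotomicOmega p (m + 1)).map (Int.castRingHom (padicCoeffIntegers S')) : (padicCoeffIntegers S')[X]) :
    IwasawaAlgebraO S') with hωn
  set ωm : IwasawaAlgebraO S' := (((cyclotomicOmega p m).map (Int.castRingHom (padicCoeffIntegers S')) : (padicCoeffIntegers S')[X]) :
    IwasawaAlgebraO S') with hωm
  set sg : IwasawaAlgebraO S' := (-1) ^ ((m + 1) / 2 + 1) with hsg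
  set Z : IwasawaAlgebraO S' := PowerSeries.C c * (Uinv * Y) - PowerSeries.C d * L with hZ
  have hsg2 : sg * sg = 1 := by
    rw [hsg, ← pow_add, ← two_mul, pow_mul, neg_one_sq, one_pow]
  -- the signed factor `((-1)^… * ω^∓).map = sg * ωs`
  have hW : ((((-1) ^ ((m + 1) / 2 + 1) * (if ε = 1 then cyclotomicOmegaMinus p (m + 1) else cyclotomicOmegaPlus p (m + 1))).map
          (Int.castRingHom (padicCoeffIntegers S')) : (padicCoeffIntegers S')[X]) : IwasawaAlgebraO S') = sg * ωs := by
    rw [Polynomial.map_mul, Polynomial.map_pow, Polynomial.map_neg, Polynomial.map_one, Polynomial.coe_mul, Polynomial.coe_pow,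
      Polynomial.coe_neg, Polynomial.coe_one]
  rw [hW] at hL
  -- (1) `ω_n = ω_m · Φ`, (2) `Φ = p + ω_m·H`, (3) `ω_m = ωs · V`
  have hωn_fac : ωn = ωm * Φ := by
    rw [hωn, hωm, hΦ, cyclotomicOmega_succ, Polynomial.map_mul, Polynomial.coe_mul]
  obtain ⟨H, hH⟩ := exists_cyclotomic_comp_X_add_one_eq_C_add_mul p m
  have hΦ_bez : Φ = PowerSeries.C ((p : ℕ) : padicCoeffIntegers S') +
      ωm * ((H.map (Int.castRingHom (padicCoeffIntegers S')) : (padicCoeffIntegers S')[X]) : IwasawaAlgebraO S') := by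
    rw [hΦ, hH, Polynomial.map_add, Polynomial.map_mul, Polynomial.map_C, Polynomial.coe_add, Polynomial.coe_mul, Polynomial.coe_C, hωm,
      eq_intCast, Int.cast_natCast]
  obtain ⟨V, hV⟩ := omegaSign_succ_dvd_cyclotomicOmega p ε m hpar
  have hωm_fac : ωm = ωs * ((V.map (Int.castRingHom (padicCoeffIntegers S')) : (padicCoeffIntegers S')[X]) : IwasawaAlgebraO S') := by
    rw [hωm, hV, Polynomial.map_mul, Polynomial.coe_mul, hωs]
  -- (4) the comparison polynomial is divisible by `Φ` in `𝒪[T]`, hence in `𝒪⟦T⟧`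
  have hBdvd : Φ ∣ ((Polynomial.C c * R - Polynomial.C ((-1) ^ ((m + 1) / 2 + 1) * d) * u * Θ : (padicCoeffIntegers S')[X]) : IwasawaAlgebraO S') := by
    rw [hΦ]
    refine coe_cyclotomic_comp_X_add_one_dvd_coe_of_map_subtype_dvd (padicCoeffIntegers S') (p ^ (m + 1)) ?_
    exact cyclotomic_comp_X_add_one_dvd_of_forall_isPrimitiveRoot (pow_pos hp.out.pos _) hval
  obtain ⟨G, hG⟩ := hBdvd
  have hB : ((Polynomial.C c * R - Polynomial.C ((-1) ^ ((m + 1) / 2 + 1) * d) * u * Θ : (padicCoeffIntegers S')[X]) : IwasawaAlgebraO S') =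
      PowerSeries.C c * (R : IwasawaAlgebraO S') - sg * PowerSeries.C d * (u : IwasawaAlgebraO S') * (Θ : IwasawaAlgebraO S') := by
    rw [Polynomial.coe_sub, Polynomial.coe_mul, Polynomial.coe_mul, Polynomial.coe_mul, Polynomial.coe_C, Polynomial.coe_C, map_mul, map_pow,
      map_neg, map_one, hsg]
  rw [hB] at hG
  -- (5) the level computation: `p^N · ωs · (U·Z) = Φ · W₁`
  have hUZ : U * Z = PowerSeries.C c * Y - PowerSeries.C d * U * L := by
    linear_combination U * hZ + (PowerSeries.C c * Y) * hU
  have e1 : ωs * Y = (R : IwasawaAlgebraO S') + ωn * q₁ := by linear_combination hread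
  have e2 : PowerSeries.C (((p : ℕ) : padicCoeffIntegers S') ^ N) * (ωs * L) =
      sg * (PowerSeries.C (((p : ℕ) : padicCoeffIntegers S') ^ N) * (Θ : IwasawaAlgebraO S') - ωn * q₂) := by
    linear_combination (-sg) * hL - (PowerSeries.C (((p : ℕ) : padicCoeffIntegers S') ^ N) * (ωs * L)) * hsg2
  have e3 : U = (u : IwasawaAlgebraO S') + ωn * q₃ := by linear_combination hu
  have hstar : PowerSeries.C (((p : ℕ) : padicCoeffIntegers S') ^ N) * (ωs * (U * Z)) =
      Φ * (PowerSeries.C (((p : ℕ) : padicCoeffIntegers S') ^ N) * G +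
        ωm * (PowerSeries.C c * PowerSeries.C (((p : ℕ) : padicCoeffIntegers S') ^ N) * q₁ + PowerSeries.C d * U * sg * q₂ -
          PowerSeries.C (((p : ℕ) : padicCoeffIntegers S') ^ N) * sg * PowerSeries.C d * q₃ * (Θ : IwasawaAlgebraO S'))) := by
    linear_combination (PowerSeries.C (((p : ℕ) : padicCoeffIntegers S') ^ N) * ωs) * hUZ +
      (PowerSeries.C c * PowerSeries.C (((p : ℕ) : padicCoeffIntegers S') ^ N)) * e1 - (PowerSeries.C d * U) * e2 -
      (sg * PowerSeries.C d * PowerSeries.C (((p : ℕ) : padicCoeffIntegers S') ^ N) * (Θ : IwasawaAlgebraO S')) * e3 +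
      PowerSeries.C (((p : ℕ) : padicCoeffIntegers S') ^ N) * hG +
      (PowerSeries.C c * PowerSeries.C (((p : ℕ) : padicCoeffIntegers S') ^ N) * q₁ + PowerSeries.C d * U * sg * q₂ -
        PowerSeries.C (((p : ℕ) : padicCoeffIntegers S') ^ N) * sg * PowerSeries.C d * q₃ * (Θ : IwasawaAlgebraO S')) * hωn_fac
  -- (6) Bezout: `p^{N+1} · (U·Z) = Φ·(p^N·(U·Z)) − H·V·(p^N·ωs·(U·Z)) ∈ Φ·𝒪⟦T⟧`
  have ep : PowerSeries.C (((p : ℕ) : padicCoeffIntegers S') ^ (N + 1)) =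
      PowerSeries.C (((p : ℕ) : padicCoeffIntegers S') ^ N) * PowerSeries.C ((p : ℕ) : padicCoeffIntegers S') := by
    rw [← map_mul, pow_succ]
  have hstar2 : PowerSeries.C (((p : ℕ) : padicCoeffIntegers S') ^ (N + 1)) * (U * Z) =
      Φ * (PowerSeries.C (((p : ℕ) : padicCoeffIntegers S') ^ N) * (U * Z) -
        ((H.map (Int.castRingHom (padicCoeffIntegers S')) : (padicCoeffIntegers S')[X]) : IwasawaAlgebraO S') *
          ((V.map (Int.castRingHom (padicCoeffIntegers S')) : (padicCoeffIntegers S')[X]) : IwasawaAlgebraO S') *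
          (PowerSeries.C (((p : ℕ) : padicCoeffIntegers S') ^ N) * G +
            ωm * (PowerSeries.C c * PowerSeries.C (((p : ℕ) : padicCoeffIntegers S') ^ N) * q₁ + PowerSeries.C d * U * sg * q₂ -
              PowerSeries.C (((p : ℕ) : padicCoeffIntegers S') ^ N) * sg * PowerSeries.C d * q₃ * (Θ : IwasawaAlgebraO S')))) := by
    rw [ep]
    linear_combination (-(PowerSeries.C (((p : ℕ) : padicCoeffIntegers S') ^ N) * (U * Z))) * hΦ_bez +
      (-(PowerSeries.C (((p : ℕ) : padicCoeffIntegers S') ^ N) * (U * Z) *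
        ((H.map (Int.castRingHom (padicCoeffIntegers S')) : (padicCoeffIntegers S')[X]) : IwasawaAlgebraO S'))) * hωm_fac +
      (-(((H.map (Int.castRingHom (padicCoeffIntegers S')) : (padicCoeffIntegers S')[X]) : IwasawaAlgebraO S') *
        ((V.map (Int.castRingHom (padicCoeffIntegers S')) : (padicCoeffIntegers S')[X]) : IwasawaAlgebraO S'))) * hstar
  -- (7) cancel `p^{N+1}` against the distinguished `Φ`
  have hΦω : (cyclotomic (p ^ (m + 1)) ℤ).comp (X + 1) ∣ cyclotomicOmega p (m + 1) :=
    ⟨cyclotomicOmega p m, by rw [cyclotomicOmega_succ, mul_comm]⟩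
  have hΦred : PowerSeries.map (IsLocalRing.residue (padicCoeffIntegers S')) Φ ≠ 0 := by
    rw [hΦ, map_residue_coe_eq_X_pow p (monic_cyclotomic_comp_X_add_one (p ^ (m + 1))) hΦω]
    exact pow_ne_zero _ PowerSeries.X_ne_zero
  obtain ⟨y, hy⟩ := exists_eq_mul_of_C_mul_eq_mul_of_ne_zero (natCast_pow_ne_zero_padicCoeffIntegers (N + 1)) hΦred hstar2
  refine ⟨Uinv * y, ?_⟩
  calc Z = Uinv * (U * Z) := by linear_combination (-Z) * hU
    _ = Φ * (Uinv * y) := by rw [hy]; ring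

/-! ## §2 All levels of parity `ε`: the identity principle -/

/-- ★★★ **Values at primitive characters pin the Coleman image to the signed `p`-adic `L`-function**: under the β4 readout for `Y ∈ 𝒪_S⟦T⟧`, the prefix's `hcongr` for
`L ∈ 𝒪_T⟦T⟧` with integral lifts `Θ_n` of `θ_n`, a unit `U` with representatives `u_n (mod ω_n)`, and the value identities `d·u_n(ζ−1)·θ_n(ζ−1) = (−1)^{n/2+1}·c·R_n(ζ−1)` at every
PRIMITIVE `pⁿ`-th root of unity for all `n ≥ n₀` of parity `ε`: `c·ι_S(U⁻¹·Y) = d·ι_T(L)` in `ℚ̄_p⟦T⟧`. [cite: Kobayashi2003, Thm. 6.3] [cite: Pollack2003, §6.5 Prop. 6.18]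
[cite: Washington1997, §7.1 Prop. 7.2] -/
theorem C_mul_iwasawaO_eq_of_primitive_values (S T : Set (PadicAlgCl p)) [FiniteDimensional ℚ_[p] (padicCoeffField (S ∪ T))]
    (ε : ℤˣ) (θ : ℕ → (PadicAlgCl p)[X]) (Θ : ℕ → (padicCoeffIntegers T)[X]) (hΘ : ∀ n, (Θ n).map (padicCoeffIntegers T).subtype = θ n)
    (L : IwasawaAlgebraO T)
    (hL : ∀ n : ℕ, (Even n ↔ ε = 1) → IsCongrModOmegaO T n (θ n)
      (((((-1) ^ (n / 2 + 1) * (if ε = 1 then cyclotomicOmegaMinus p n else cyclotomicOmegaPlus p n)).map (Int.castRingHom (PadicAlgCl p)) :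
          (PadicAlgCl p)[X]) : PowerSeries (PadicAlgCl p)) * iwasawaOToPowerSeries T L))
    (Y : IwasawaAlgebraO S) (ev : ℕ → ℕ → padicCoeffIntegers S)
    (hread : ∀ n : ℕ, (Even n ↔ ε = 1) →
      (((if ε = 1 then cyclotomicOmegaMinus p n else cyclotomicOmegaPlus p n).map (Int.castRingHom (padicCoeffIntegers S)) :
          (padicCoeffIntegers S)[X]) : IwasawaAlgebraO S) * Y -
          ∑ i ∈ Finset.range (p ^ n), PowerSeries.C (ev n i) * (1 + PowerSeries.X : IwasawaAlgebraO S) ^ (p ^ n - i) ∈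
        Ideal.span {(1 + PowerSeries.X : IwasawaAlgebraO S) ^ p ^ n - 1})
    (U : (IwasawaAlgebraO S)ˣ) (u : ℕ → (padicCoeffIntegers S)[X])
    (hu : ∀ n : ℕ, (Even n ↔ ε = 1) → (U : IwasawaAlgebraO S) - (u n : IwasawaAlgebraO S) ∈ Ideal.span {(1 + PowerSeries.X : IwasawaAlgebraO S) ^ p ^ n - 1})
    (c d : padicCoeffIntegers (S ∪ T))
    (hval : ∃ n₀ : ℕ, ∀ n : ℕ, n₀ ≤ n → (Even n ↔ ε = 1) → ∀ ζ : PadicAlgCl p, IsPrimitiveRoot ζ (p ^ n) →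
      (d : PadicAlgCl p) * ((u n).map (padicCoeffIntegers S).subtype).eval (ζ - 1) * (θ n).eval (ζ - 1) =
        (-1) ^ (n / 2 + 1) * (c : PadicAlgCl p) * ∑ i ∈ Finset.range (p ^ n), (ev n i : PadicAlgCl p) * ζ ^ (p ^ n - i)) :
    PowerSeries.C (c : PadicAlgCl p) * iwasawaOToPowerSeries S (↑U⁻¹ * Y) = PowerSeries.C (d : PadicAlgCl p) * iwasawaOToPowerSeries T L := by
  classical
  obtain ⟨n₀, hval⟩ := hval
  haveI : IsDiscreteValuationRing (padicCoeffIntegers (S ∪ T)) := isDiscreteValuationRing_padicCoeffIntegers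
  haveI : CharP (IsLocalRing.ResidueField (padicCoeffIntegers (S ∪ T))) p := charP_residueField_padicCoeffIntegers
  have hS : S ⊆ S ∪ T := Set.subset_union_left
  have hT : T ⊆ S ∪ T := Set.subset_union_right
  have hcompS : (padicCoeffIntegers (S ∪ T)).subtype.comp (Subring.inclusion (padicCoeffIntegers_mono hS)) = (padicCoeffIntegers S).subtype :=
    RingHom.ext fun _ ↦ rfl
  have hcompT : (padicCoeffIntegers (S ∪ T)).subtype.comp (Subring.inclusion (padicCoeffIntegers_mono hT)) = (padicCoeffIntegers T).subtype :=
    RingHom.ext fun _ ↦ rfl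
  -- move everything to `𝒪' = 𝒪_{S ∪ T}`
  set φS : IwasawaAlgebraO S →+* IwasawaAlgebraO (S ∪ T) := PowerSeries.map (Subring.inclusion (padicCoeffIntegers_mono hS)) with hφS
  set φT : IwasawaAlgebraO T →+* IwasawaAlgebraO (S ∪ T) := PowerSeries.map (Subring.inclusion (padicCoeffIntegers_mono hT)) with hφT
  set Z : IwasawaAlgebraO (S ∪ T) := PowerSeries.C c * φS (↑U⁻¹ * Y) - PowerSeries.C d * φT L with hZ
  -- it suffices that `Z = 0`
  suffices hZ0 : Z = 0 by
    have h := congrArg (iwasawaOToPowerSeries (S ∪ T)) hZ0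
    simp only [hZ, map_sub, map_mul, map_zero, hφS, hφT, iwasawaOToPowerSeries_inclΛ hS, iwasawaOToPowerSeries_inclΛ hT,
      iwasawaOToPowerSeries_C] at h
    rw [map_mul]
    exact sub_eq_zero.mp h
  have hUU : φS (U : IwasawaAlgebraO S) * φS ↑U⁻¹ = 1 := by rw [← map_mul, Units.mul_inv, map_one]
  -- integer polynomials and `(1+X)^{pⁿ} − 1` under `φS`, `φT`
  have hφS_int : ∀ P : ℤ[X], φS ((P.map (Int.castRingHom (padicCoeffIntegers S)) : (padicCoeffIntegers S)[X]) : IwasawaAlgebraO S) =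
      ((P.map (Int.castRingHom (padicCoeffIntegers (S ∪ T))) : (padicCoeffIntegers (S ∪ T))[X]) : IwasawaAlgebraO (S ∪ T)) :=
    fun P ↦ inclΛ_coe_map hS P
  have hωS : ∀ n : ℕ, ((1 + PowerSeries.X : IwasawaAlgebraO S) ^ p ^ n - 1) =
      (((cyclotomicOmega p n).map (Int.castRingHom (padicCoeffIntegers S)) : (padicCoeffIntegers S)[X]) : IwasawaAlgebraO S) := fun n ↦
    (coe_map_cyclotomicOmega p n).symm
  -- ONE LEVEL `n = m + 1 ≥ n₀` of parity `ε`: `Φ_{pⁿ}(1+T) ∣ Z`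
  have hlevel : ∀ m : ℕ, n₀ ≤ m + 1 → (Even (m + 1) ↔ ε = 1) →
      ((((cyclotomic (p ^ (m + 1)) ℤ).comp (X + 1)).map (Int.castRingHom (padicCoeffIntegers (S ∪ T))) : (padicCoeffIntegers (S ∪ T))[X]) :
        IwasawaAlgebraO (S ∪ T)) ∣ Z := by
    intro m hm hpar
    obtain ⟨q₁, hq₁⟩ := Ideal.mem_span_singleton.mp (hread (m + 1) hpar)
    obtain ⟨q₃, hq₃⟩ := Ideal.mem_span_singleton.mp (hu (m + 1) hpar)
    obtain ⟨N, q₂, hq₂⟩ := IsCongrModOmegaO.of_subset hT (hL (m + 1) hpar)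
    -- the data at this level, in `𝒪'`
    set Θ' : (padicCoeffIntegers (S ∪ T))[X] := (Θ (m + 1)).map (Subring.inclusion (padicCoeffIntegers_mono hT)) with hΘ'
    set u' : (padicCoeffIntegers (S ∪ T))[X] := (u (m + 1)).map (Subring.inclusion (padicCoeffIntegers_mono hS)) with hu'
    set R' : (padicCoeffIntegers (S ∪ T))[X] := ∑ i ∈ Finset.range (p ^ (m + 1)),
      Polynomial.C (Subring.inclusion (padicCoeffIntegers_mono hS) (ev (m + 1) i)) * (1 + X) ^ (p ^ (m + 1) - i) with hR'
    have hR'coe : (R' : IwasawaAlgebraO (S ∪ T)) =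
        φS (∑ i ∈ Finset.range (p ^ (m + 1)), PowerSeries.C (ev (m + 1) i) * (1 + PowerSeries.X : IwasawaAlgebraO S) ^ (p ^ (m + 1) - i)) := by
      simp only [hR', coe_finset_sum, map_sum, map_mul, map_pow, map_add, map_one, Polynomial.coe_mul, Polynomial.coe_C, Polynomial.coe_pow,
        Polynomial.coe_add, Polynomial.coe_one, Polynomial.coe_X, hφS, PowerSeries.map_C, PowerSeries.map_X]
    have hu'coe : (u' : IwasawaAlgebraO (S ∪ T)) = φS (u (m + 1) : IwasawaAlgebraO S) := by
      rw [hu', Polynomial.polynomial_map_coe, hφS]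
    have hΘ'coe : (Θ' : IwasawaAlgebraO (S ∪ T)) = φT (Θ (m + 1) : IwasawaAlgebraO T) := by
      rw [hΘ', Polynomial.polynomial_map_coe, hφT]
    have hθcoe : iwasawaOToPowerSeries T (Θ (m + 1) : IwasawaAlgebraO T) = ((θ (m + 1) : (PadicAlgCl p)[X]) : PowerSeries (PadicAlgCl p)) := by
      rw [← hΘ (m + 1), Polynomial.polynomial_map_coe, iwasawaOToPowerSeries]
    rw [hZ, map_mul]
    refine cyclotomic_comp_dvd_of_level_values (S ∪ T) ε m hpar Θ' u' R' (φT L) (φS Y) (φS ↑U) (φS ↑U⁻¹) (φS q₁) q₂ (φS q₃) hUU N c d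
      ?_ ?_ ?_ ?_
    · -- readout, transported
      have h := congrArg φS hq₁
      rw [map_mul, hωS (m + 1), hφS_int] at h
      rw [← h, map_sub, map_mul, hφS_int, hR'coe]
    · -- representative, transported
      have h := congrArg φS hq₃
      rw [map_mul, hωS (m + 1), hφS_int] at h
      rw [← h, map_sub, hu'coe]
    · -- the congruence, pulled back to `𝒪'⟦T⟧` along the injective `ι`
      apply iwasawaOToPowerSeries_injective (S ∪ T)
      simp only [map_mul, map_sub, iwasawaOToPowerSeries_C_natCast_pow, iwasawaOToPowerSeries_coe_map, hΘ'coe, hφT, iwasawaOToPowerSeries_inclΛ hT,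
        hθcoe]
      exact hq₂
    · -- the value identity at primitive roots
      intro ζ hζ
      have hv := hval (m + 1) hm hpar ζ hζ
      have hsK : ((-1 : PadicAlgCl p) ^ ((m + 1) / 2 + 1)) * ((-1 : PadicAlgCl p) ^ ((m + 1) / 2 + 1)) = 1 := by
        rw [← pow_add, ← two_mul, pow_mul, neg_one_sq, one_pow]
      have hmapu : u'.map (padicCoeffIntegers (S ∪ T)).subtype = (u (m + 1)).map (padicCoeffIntegers S).subtype := by
        rw [hu', Polynomial.map_map, hcompS]
      have hmapΘ : Θ'.map (padicCoeffIntegers (S ∪ T)).subtype = θ (m + 1) := by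
        rw [hΘ', Polynomial.map_map, hcompT, hΘ]
      have hmapR : (R'.map (padicCoeffIntegers (S ∪ T)).subtype).eval (ζ - 1) =
          ∑ i ∈ Finset.range (p ^ (m + 1)), (ev (m + 1) i : PadicAlgCl p) * ζ ^ (p ^ (m + 1) - i) := by
        rw [hR', Polynomial.map_sum, eval_finsetSum]
        refine Finset.sum_congr rfl fun i _ ↦ ?_
        rw [Polynomial.map_mul, Polynomial.map_C, Polynomial.map_pow, Polynomial.map_add, Polynomial.map_one, Polynomial.map_X, eval_mul, eval_C,
          eval_pow, eval_add, eval_one, eval_X, add_sub_cancel, Subring.coe_subtype, coe_inclO hS]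
      rw [Polynomial.map_sub, Polynomial.map_mul, Polynomial.map_mul, Polynomial.map_mul, Polynomial.map_C, Polynomial.map_C, eval_sub, eval_mul,
        eval_mul, eval_mul, eval_C, eval_C, hmapu, hmapΘ, hmapR, map_mul, map_pow, map_neg, map_one, Subring.coe_subtype]
      linear_combination (-((-1 : PadicAlgCl p) ^ ((m + 1) / 2 + 1))) * hv -
        ((c : PadicAlgCl p) * ∑ i ∈ Finset.range (p ^ (m + 1)), (ev (m + 1) i : PadicAlgCl p) * ζ ^ (p ^ (m + 1) - i)) * hsK
  -- ALL LEVELS: unbounded distinguished divisors force `Z = 0`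
  have hΦω : ∀ m : ℕ, (cyclotomic (p ^ (m + 1)) ℤ).comp (X + 1) ∣ cyclotomicOmega p (m + 1) :=
    fun m ↦ ⟨cyclotomicOmega p m, by rw [cyclotomicOmega_succ, mul_comm]⟩
  rcases Int.units_eq_one_or ε with rfl | rfl
  · -- `ε = 1`: even levels `n = 2(n₀+k+1)`
    exact eq_zero_of_forall_dvd_of_map_eq_X_pow
      (fun k : ℕ ↦ ((((cyclotomic (p ^ (2 * (n₀ + k) + 1 + 1)) ℤ).comp (X + 1)).map (Int.castRingHom (padicCoeffIntegers (S ∪ T))) :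
        (padicCoeffIntegers (S ∪ T))[X]) : IwasawaAlgebraO (S ∪ T)))
      (fun k ↦ ((cyclotomic (p ^ (2 * (n₀ + k) + 1 + 1)) ℤ).comp (X + 1)).natDegree)
      (fun k ↦ map_residue_coe_eq_X_pow p (monic_cyclotomic_comp_X_add_one _) (hΦω _))
      (fun k ↦ ⟨k, lt_of_le_of_lt (by omega) (lt_natDegree_cyclotomic_comp_X_add_one p (2 * (n₀ + k) + 1))⟩)
      (fun k ↦ hlevel (2 * (n₀ + k) + 1) (by omega) ⟨fun _ ↦ rfl, fun _ ↦ ⟨n₀ + k + 1, by ring⟩⟩)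
  · -- `ε = −1`: odd levels `n = 2(n₀+k)+1`
    have hne : ((-1 : ℤˣ) = 1) ↔ False := ⟨fun h ↦ by simp at h, False.elim⟩
    have hpar : ∀ k : ℕ, Even (2 * (n₀ + k) + 1) ↔ (-1 : ℤˣ) = 1 := fun k ↦ by
      rw [hne, iff_false, Nat.not_even_iff_odd]
      exact ⟨n₀ + k, rfl⟩
    exact eq_zero_of_forall_dvd_of_map_eq_X_pow
      (fun k : ℕ ↦ ((((cyclotomic (p ^ (2 * (n₀ + k) + 1)) ℤ).comp (X + 1)).map (Int.castRingHom (padicCoeffIntegers (S ∪ T))) :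
        (padicCoeffIntegers (S ∪ T))[X]) : IwasawaAlgebraO (S ∪ T)))
      (fun k ↦ ((cyclotomic (p ^ (2 * (n₀ + k) + 1)) ℤ).comp (X + 1)).natDegree)
      (fun k ↦ map_residue_coe_eq_X_pow p (monic_cyclotomic_comp_X_add_one _) (hΦω _))
      (fun k ↦ ⟨k, lt_of_le_of_lt (by omega) (lt_natDegree_cyclotomic_comp_X_add_one p (2 * (n₀ + k)))⟩)
      (fun k ↦ hlevel (2 * (n₀ + k)) (by omega) (hpar k))

/-! ## §3 The registered shape: levelwise Mazur–Tate congruences for `U⁻¹·Y` -/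

/-- ★★★ **S4″ FROM VALUES AT PRIMITIVE CHARACTERS.** Same inputs as `C_mul_iwasawaO_eq_of_primitive_values`; conclusion in the exact shape of the registered `CharRoadRecipMT`:
for every `n` of parity `ε`, `d·θ_n ≡ (−1)^{n/2+1}·ω_n^∓·(c·ι_S(U⁻¹·Y)) (mod ω_n)` in `𝒪_{S∪T}⟦T⟧ ⊗ ℚ` (`IsCongrModOmegaO (S ∪ T)`). With `Y := Col₀(jv(s ζ̄_𝔞))` this is the stub's conclusion
for the Coleman equivalence `Col := U⁻¹•Col₀` and the constants `(c, d)`. [cite: Kobayashi2003, Thm. 6.3] [cite: Pollack2003, §6.5 Prop. 6.18] [cite: PollackRubin2004, §6–§7] -/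
theorem isCongrModOmegaO_of_primitive_values (S T : Set (PadicAlgCl p)) [FiniteDimensional ℚ_[p] (padicCoeffField (S ∪ T))]
    (ε : ℤˣ) (θ : ℕ → (PadicAlgCl p)[X]) (Θ : ℕ → (padicCoeffIntegers T)[X]) (hΘ : ∀ n, (Θ n).map (padicCoeffIntegers T).subtype = θ n)
    (L : IwasawaAlgebraO T)
    (hL : ∀ n : ℕ, (Even n ↔ ε = 1) → IsCongrModOmegaO T n (θ n)
      (((((-1) ^ (n / 2 + 1) * (if ε = 1 then cyclotomicOmegaMinus p n else cyclotomicOmegaPlus p n)).map (Int.castRingHom (PadicAlgCl p)) :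
          (PadicAlgCl p)[X]) : PowerSeries (PadicAlgCl p)) * iwasawaOToPowerSeries T L))
    (Y : IwasawaAlgebraO S) (ev : ℕ → ℕ → padicCoeffIntegers S)
    (hread : ∀ n : ℕ, (Even n ↔ ε = 1) →
      (((if ε = 1 then cyclotomicOmegaMinus p n else cyclotomicOmegaPlus p n).map (Int.castRingHom (padicCoeffIntegers S)) :
          (padicCoeffIntegers S)[X]) : IwasawaAlgebraO S) * Y -
          ∑ i ∈ Finset.range (p ^ n), PowerSeries.C (ev n i) * (1 + PowerSeries.X : IwasawaAlgebraO S) ^ (p ^ n - i) ∈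
        Ideal.span {(1 + PowerSeries.X : IwasawaAlgebraO S) ^ p ^ n - 1})
    (U : (IwasawaAlgebraO S)ˣ) (u : ℕ → (padicCoeffIntegers S)[X])
    (hu : ∀ n : ℕ, (Even n ↔ ε = 1) → (U : IwasawaAlgebraO S) - (u n : IwasawaAlgebraO S) ∈ Ideal.span {(1 + PowerSeries.X : IwasawaAlgebraO S) ^ p ^ n - 1})
    (c d : padicCoeffIntegers (S ∪ T))
    (hval : ∃ n₀ : ℕ, ∀ n : ℕ, n₀ ≤ n → (Even n ↔ ε = 1) → ∀ ζ : PadicAlgCl p, IsPrimitiveRoot ζ (p ^ n) →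
      (d : PadicAlgCl p) * ((u n).map (padicCoeffIntegers S).subtype).eval (ζ - 1) * (θ n).eval (ζ - 1) =
        (-1) ^ (n / 2 + 1) * (c : PadicAlgCl p) * ∑ i ∈ Finset.range (p ^ n), (ev n i : PadicAlgCl p) * ζ ^ (p ^ n - i))
    (n : ℕ) (hn : Even n ↔ ε = 1) :
    IsCongrModOmegaO (S ∪ T) n (Polynomial.C (d : PadicAlgCl p) * θ n)
      (((((-1) ^ (n / 2 + 1) * (if ε = 1 then cyclotomicOmegaMinus p n else cyclotomicOmegaPlus p n)).map (Int.castRingHom (PadicAlgCl p)) :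
          (PadicAlgCl p)[X]) : PowerSeries (PadicAlgCl p)) * (PowerSeries.C (c : PadicAlgCl p) * iwasawaOToPowerSeries S (↑U⁻¹ * Y))) := by
  have key := C_mul_iwasawaO_eq_of_primitive_values S T ε θ Θ hΘ L hL Y ev hread U u hu c d hval
  have hT : T ⊆ S ∪ T := Set.subset_union_right
  have h : IsCongrModOmegaO (S ∪ T) n (θ n) _ := IsCongrModOmegaO.of_subset hT (hL n hn)
  rw [← iwasawaOToPowerSeries_inclΛ hT L] at h
  have h2 := IsCongrModOmegaO.C_mul h d
  rw [map_mul, iwasawaOToPowerSeries_C, iwasawaOToPowerSeries_inclΛ hT L, ← key] at h2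
  exact h2

end Summit.BirchSwinnertonDyer.BirchSwinnertonDyer.Theorems.SmallImageRttReciprocity

end
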